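import Summits.BirchSwinnertonDyer.BirchSwinnertonDyer.Theorems.ManinLocalTwoThreePinningKernelSieve
import Summits.BirchSwinnertonDyer.BirchSwinnertonDyer.Theorems.ManinLocalTwoThreeEtaCoefficientTables
import Literature.NumberTheory.ModularForms.EtaQuotientModularForms
import HarnessLib

/-!
# THE PINNING KERNEL, part B: integer dual certificates, the pinning from a candidate, certified `η`-bases

Cell `bsd-f2-manin`, route `ManinLocalTwoThree`, cruxes C2 `ManinOddAtFour` (stmt-BirchSwinnertonDyer-22967) and
C3 `ManinPrimeToThreeAtNine` (stmt-22968); planner seat -an gen 54 (`--supports` helper, turnkey T-an-g54-PK).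
Level-generic; nothing here proves C2, C3, Manin's conjecture or BSD.

WHAT IT REPLACES.  At every level done so far (44, 45, 52, 54, 56) the step "the newform `D.f` of an `X₀(N)`-datum IS the
explicit form `Φ`" was a hand-written chain (`Basis…`, `BasisSolve…`, `CurveSide…`, `CurveExclusion…`, `NewformPinning…`:
8 files at level 45, 12 at level 52) of `linear_combination` eliminations growing like `g²`.  Parts A + B do that step ONCE
for all levels, from integer data checked by `decide +kernel` (first instance `…PinningSixtyThree.lean`: six certificates).

* §1 (abstract linear algebra over any `ℂ`-space `V` with coefficient functionals `coef n : V →ₗ[ℂ] ℂ`).  A family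
  `C : Fin g → V` with CERTIFIED integer coefficient tables `t i` to depth `K` (`∀ n < K, t i[n] = coef n (C i)`) and a DUAL
  CERTIFICATE (integer vectors `u i` of length `≤ K` with `⟨u i, t j⟩ = d·δ_ij`, `d ≠ 0` — decidable) is linearly
  independent (`linearIndependent_of_dual`); if `finrank V = g` it spans, every integer column relation certified on the
  tables (`∀ j, ⟨v, t j⟩ = 0`) holds on all of `V` (`evalFnₗ_eq_zero_of_dual`), and two vectors with equal coefficients
  on the support of the `u i` are equal (`eq_of_dual`).  §1b: the instance `V = M_k(Γ₀(N))`, `coef n = aₙ` (`modCoefₗ`;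
  for `S_k` the tree's `cuspCoeffₗ`), and `aₙ(D.f) = aₙ(W)` read in `M₂` (`modCoefₗ_newform`).
* §3 PINNING: the certified relations feed part A's sieve (`truth_mem_runSieve_of_cert`: the candidate list is COMPLETE),
  and for a candidate `σ` with integers `d', y` such that `d'·aₙ(σ) = Σ_j y_j·t_j[n]` on the dual support (decidable),
  `d' • F = Σ_j y_j • C_j` for the newform `F` (`smul_eq_sum_of_candidate`, list form `exists_smul_eq_sum_of_certs`).
* §4 CERTIFIED `η`-BASES of `M₂(Γ₀(N))`: a list of (exponent list, Newman witness) passing the decidable Newman–Ligozat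
  check IS a family of modular forms (`exists_etaModularForms`, Mathlib-structure `etaQuotientModularForm`), and lists
  passing the convolution certificates of `…EtaCoefficientTables` ARE their `q`-tables (`tables_of_etaCerts`).
Per level the residual input is DATA (an g54 `scripts/pk_data.py N K` emits it) plus the exclusion of the non-new
candidates (`p`-depleted old classes survive every curve-side constraint; Fricke/oldform step, per level for now).
[cite: CremonaAlgorithms1997, §2.10] [cite: DiamondShurman2005, Thm. 3.5.1] [cite: Koehler2011, §2.1] [cite: Ligozat1975, Ch. 3]
-/

set_option autoImplicit false
-- lint-debt: the directory name repeats the summit name (sibling precedent `ManinLocalTwoThreeNewformPinningFiftySix.lean`)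
set_option linter.dupNamespace false

noncomputable section

open Complex
open UpperHalfPlane hiding I
open scoped MatrixGroups ModularForm
open ModularForm CongruenceSubgroup
open Literature.NumberTheory.ModularForms
open Literature.NumberTheory.EllipticCurves Literature.NumberTheory.EllipticCurves.ModularForms

namespace Summit.BirchSwinnertonDyer.BirchSwinnertonDyer.Theorems.ManinLocalTwoThree.PinningKernel

open Summit.BirchSwinnertonDyer.BirchSwinnertonDyer.Theorems.ManinLocalTwoThree.BracketSturm

/-! ## §1 Integer dual certificates: independence, span, relations, separation -/

section LinearAlgebra

variable {V : Type*} [AddCommGroup V] [Module ℂ V]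

/-- `⟨u, t⟩ = Σ_{n < |u|} uₙ tₙ` (entries beyond a list's end count as `0`). [folklore] -/
def dotList (u t : List ℤ) : ℤ := ∑ n ∈ Finset.range u.length, u.getD n 0 * t.getD n 0

/-- The functional `Σ_{n < |u|} uₙ · coef n`. [folklore] -/
def evalFnₗ (coef : ℕ → V →ₗ[ℂ] ℂ) (u : List ℤ) : V →ₗ[ℂ] ℂ :=
  ∑ n ∈ Finset.range u.length, ((u.getD n 0 : ℤ) : ℂ) • coef n

/-- `evalFnₗ` evaluated at a vector. [folklore] -/
theorem evalFnₗ_apply (coef : ℕ → V →ₗ[ℂ] ℂ) (u : List ℤ) (v : V) :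
    evalFnₗ coef u v = ∑ n ∈ Finset.range u.length, ((u.getD n 0 : ℤ) : ℂ) * coef n v := by
  simp only [evalFnₗ, LinearMap.coe_sum, Finset.sum_apply, LinearMap.smul_apply, smul_eq_mul]

/-- On a certified vector the functional is the integer dot product. [folklore] -/
theorem evalFnₗ_eq_dotList {coef : ℕ → V →ₗ[ℂ] ℂ} {K : ℕ} {t u : List ℤ} {v : V}
    (ht : ∀ n < K, ((t.getD n 0 : ℤ) : ℂ) = coef n v) (hu : u.length ≤ K) :
    evalFnₗ coef u v = (dotList u t : ℂ) := by
  rw [evalFnₗ_apply, dotList]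
  push_cast
  refine Finset.sum_congr rfl fun n hn ↦ ?_
  rw [ht n (lt_of_lt_of_le (Finset.mem_range.mp hn) hu)]

variable {g K : ℕ} {coef : ℕ → V →ₗ[ℂ] ℂ} (C : Fin g → V) (t u : Fin g → List ℤ) (d : ℤ)
  (ht : ∀ i, ∀ n < K, (((t i).getD n 0 : ℤ) : ℂ) = coef n (C i)) (hu : ∀ i, (u i).length ≤ K)
  (hdual : ∀ i j, dotList (u i) (t j) = if i = j then d else 0)

include ht hu hdual in
/-- The `i`-th dual functional on a combination reads off `d · xᵢ`. [folklore] -/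
theorem evalFnₗ_sum_smul (x : Fin g → ℂ) (i : Fin g) :
    evalFnₗ coef (u i) (∑ j, x j • C j) = x i * d := by
  rw [map_sum]
  simp_rw [map_smul, smul_eq_mul]
  rw [Finset.sum_congr rfl fun j _ ↦ by rw [evalFnₗ_eq_dotList (ht j) (hu i), hdual i j],
    Finset.sum_eq_single i (fun j _ hji ↦ by rw [if_neg (Ne.symm hji), Int.cast_zero, mul_zero])
      (fun h ↦ absurd (Finset.mem_univ i) h), if_pos rfl]

include ht hu hdual in
/-- **A dual certificate gives linear independence.** [folklore] -/
theorem linearIndependent_of_dual (hd : d ≠ 0) : LinearIndependent ℂ C := by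
  rw [Fintype.linearIndependent_iff]
  intro x hx i
  have h := evalFnₗ_sum_smul C t u d ht hu hdual x i
  rw [hx, map_zero] at h
  exact (mul_eq_zero.mp h.symm).resolve_right (Int.cast_ne_zero.mpr hd)

variable [FiniteDimensional ℂ V] (hd : d ≠ 0) (hdim : Module.finrank ℂ V = g)

include ht hu hdual hd hdim in
/-- **… and, with `dim V = g`, a basis.** [folklore] -/
theorem span_eq_top_of_dual : Submodule.span ℂ (Set.range C) = ⊤ :=
  (linearIndependent_of_dual C t u d ht hu hdual hd).span_eq_top_of_card_eq_finrank' (by rw [hdim]; simp)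

include ht hu hdual hd hdim in
/-- Coordinates exist. [folklore] -/
theorem exists_coords_of_dual (F : V) : ∃ x : Fin g → ℂ, F = ∑ j, x j • C j := by
  have hF : F ∈ Submodule.span ℂ (Set.range C) := by
    rw [span_eq_top_of_dual C t u d ht hu hdual hd hdim]; exact Submodule.mem_top
  obtain ⟨c, hc⟩ := (Submodule.mem_span_range_iff_exists_fun ℂ).mp hF
  exact ⟨c, hc.symm⟩

include ht hu hdual hd hdim in
/-- **Every certified integer column relation holds on all of `V`.**  If `⟨v, t j⟩ = 0` for all `j`
(decidable) and `|v| ≤ K`, then `Σ_{n<|v|} vₙ · coef n F = 0` for EVERY `F`. [folklore] -/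
theorem evalFnₗ_eq_zero_of_dual (v : List ℤ) (hv : ∀ j, dotList v (t j) = 0) (hvK : v.length ≤ K) (F : V) :
    evalFnₗ coef v F = 0 := by
  obtain ⟨x, rfl⟩ := exists_coords_of_dual C t u d ht hu hdual hd hdim F
  rw [map_sum]
  refine Finset.sum_eq_zero fun j _ ↦ ?_
  rw [map_smul, smul_eq_mul, evalFnₗ_eq_dotList (ht j) hvK, hv j, Int.cast_zero, mul_zero]

include ht hu hdual hd hdim in
/-- **Separation**: two vectors with the same coefficients on the support of the dual vectors are equal. [folklore] -/
theorem eq_of_dual {F G : V} (hFG : ∀ i, ∀ n < (u i).length, (u i).getD n 0 ≠ 0 → coef n F = coef n G) :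
    F = G := by
  obtain ⟨x, hx⟩ := exists_coords_of_dual C t u d ht hu hdual hd hdim (F - G)
  have hx0 : ∀ i, x i = 0 := fun i ↦ by
    have h1 : evalFnₗ coef (u i) (F - G) = 0 := by
      rw [evalFnₗ_apply]
      refine Finset.sum_eq_zero fun n hn ↦ ?_
      by_cases h0 : (u i).getD n 0 = 0
      · rw [h0, Int.cast_zero, zero_mul]
      · rw [map_sub, hFG i n (Finset.mem_range.mp hn) h0, sub_self, mul_zero]
    rw [hx, evalFnₗ_sum_smul C t u d ht hu hdual x i] at h1
    exact (mul_eq_zero.mp h1).resolve_right (Int.cast_ne_zero.mpr hd)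
  have h0 : F - G = 0 := by
    rw [hx]; exact Finset.sum_eq_zero fun j _ ↦ by rw [hx0 j, zero_smul]
  exact sub_eq_zero.mp h0

end LinearAlgebra

/-! ## §1b The instance `V = M_k(Γ₀(N))`, `coef n = aₙ`

For `V = S_k(Γ₀(N))` use the tree's `cuspCoeffₗ (one_mem_strictPeriods_coe_gamma0 N) n`
(`Literature…NewformGaloisRepIntegralityProofs`, `cuspCoeffₗ_apply`) with `D.isNewformOf.2 n`; the level files read `D.f`
in `M₂` (`ModularFormClass.modularForm D.f`), where the holomorphic `η`-quotients live. -/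

section Instances

variable (N : ℕ) (k : ℤ)

/-- `aₙ` as a linear functional on `M_k(Γ₀(N))` (Mathlib `ModularForm.qExpansion_add/_smul`). [folklore] -/
def modCoefₗ (n : ℕ) : ModularForm (Gamma0 N) k →ₗ[ℂ] ℂ where
  toFun F := (qExpansion 1 ⇑F).coeff n
  map_add' F G := by
    change (qExpansion 1 ⇑(F + G)).coeff n = (qExpansion 1 ⇑F).coeff n + (qExpansion 1 ⇑G).coeff n
    rw [show qExpansion 1 ⇑(F + G) = qExpansion 1 ⇑F + qExpansion 1 ⇑G from
      ModularForm.qExpansion_add one_pos (one_mem_strictPeriods_coe_gamma0 N) F G, map_add]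
  map_smul' c F := by
    change (qExpansion 1 ⇑(c • F)).coeff n = c * (qExpansion 1 ⇑F).coeff n
    rw [show qExpansion 1 ⇑(c • F) = c • qExpansion 1 ⇑F from
      ModularForm.qExpansion_smul one_pos (one_mem_strictPeriods_coe_gamma0 N) c F, map_smul, smul_eq_mul]

variable {N k}

/-- `modCoefₗ n` evaluated: the `n`-th `q`-coefficient. [folklore] -/
@[simp] theorem modCoefₗ_apply (n : ℕ) (F : ModularForm (Gamma0 N) k) :
    modCoefₗ N k n F = (qExpansion 1 ⇑F).coeff n := rfl

/-- The newform of an `X₀(N)`-datum read in `M₂` (Mathlib `ModularFormClass.modularForm`): `aₙ = aₙ(W)`. [folklore] -/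
theorem modCoefₗ_newform {W : WeierstrassCurve ℚ} [NeZero N] (D : ModularParametrizationData W N) (n : ℕ) :
    modCoefₗ N 2 n (ModularFormClass.modularForm D.f) = ((W.LFunction n : ℤ) : ℂ) := D.isNewformOf.2 n

end Instances
/-! ## §3 From the tables to the relations, and from a candidate to the pinning -/

section Pinning

variable {V : Type*} [AddCommGroup V] [Module ℂ V] [FiniteDimensional ℂ V] {coef : ℕ → V →ₗ[ℂ] ℂ}
  {N : ℕ} [NeZero N] {W : WeierstrassCurve ℚ} [W.IsElliptic] (D : ModularParametrizationData W N)
  (F : V) (hF : ∀ n, coef n F = ((W.LFunction n : ℤ) : ℂ))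
  {g K : ℕ} (C : Fin g → V) (t u : Fin g → List ℤ) (d : ℤ)
  (ht : ∀ i, ∀ n < K, (((t i).getD n 0 : ℤ) : ℂ) = coef n (C i)) (hu : ∀ i, (u i).length ≤ K)
  (hdual : ∀ i j, dotList (u i) (t j) = if i = j then d else 0) (hd : d ≠ 0)
  (hdim : Module.finrank ℂ V = g)

include hF ht hu hdual hd hdim in
omit [NeZero N] [W.IsElliptic] in
/-- **A certified column relation is a relation among the `aₙ(W)`** (decidable premise `∀ j, ⟨v, t j⟩ = 0`), for any
`F ∈ V` whose coefficients are the `aₙ(W)` (`F = D.f` in `S₂`, or its image in `M₂`). [cite: DiamondShurman2005, Thm. 3.5.1] -/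
theorem isRelation_of_cert {v : List ℤ} (hvK : v.length ≤ K) (hv : ∀ j, dotList v (t j) = 0) :
    v.length ≤ K ∧ ∑ n ∈ Finset.range v.length, v.getD n 0 * W.LFunction n = 0 := by
  refine ⟨hvK, ?_⟩
  have h := evalFnₗ_eq_zero_of_dual C t u d ht hu hdual hd hdim v hv hvK F
  rw [evalFnₗ_apply] at h
  have h' : ∑ n ∈ Finset.range v.length, ((v.getD n 0 : ℤ) : ℂ) * ((W.LFunction n : ℤ) : ℂ) = 0 := by
    rw [← h]; exact Finset.sum_congr rfl fun n _ ↦ by rw [hF n]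
  exact_mod_cast h'

include hF ht hu hdual hd hdim in
omit [NeZero N] [W.IsElliptic] in
/-- **All stage relations at once** from the decidable certificate. [folklore] -/
theorem stage_relations_of_cert (stages : List (ℕ × List (List ℤ)))
    (hcert : ∀ st ∈ stages, ∀ v ∈ st.2, v.length ≤ K ∧ ∀ j, dotList v (t j) = 0) :
    ∀ st ∈ stages, ∀ v ∈ st.2, v.length ≤ K ∧ ∑ n ∈ Finset.range v.length, v.getD n 0 * W.LFunction n = 0 :=
  fun st hst v hv ↦ isRelation_of_cert F hF C t u d ht hu hdual hd hdim (hcert st hst v hv).1 (hcert st hst v hv).2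

include D hF ht hu hdual hd hdim in
/-- **THE CANDIDATE LIST IS COMPLETE.**  With certified stage relations, the true prime assignment of ANY `X₀(N)`-datum
is one of the candidates returned by the sieve. [cite: CremonaAlgorithms1997, §2.10] -/
theorem truth_mem_runSieve_of_cert (stages : List (ℕ × List (List ℤ))) (hps : ∀ st ∈ stages, st.1.Prime)
    (hcert : ∀ st ∈ stages, ∀ v ∈ st.2, v.length ≤ K ∧ ∀ j, dotList v (t j) = 0) :
    truth W (stages.map Prod.fst) ∈ runSieve N K stages :=
  truth_mem_runSieve D stages hps (stage_relations_of_cert F hF C t u d ht hu hdual hd hdim stages hcert)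

include D hF ht hu hdual hd hdim in
/-- **PINNING FROM A CANDIDATE.**  If `σ` is truthful and the integers `d', y` satisfy
`d'·aₙ(σ) = Σ_j y_j·t_j[n]` at every `n` in the support of the dual vectors (decidable), then
`d' • F = Σ_j y_j • C_j`. [cite: CremonaAlgorithms1997, §2.10] -/
theorem smul_eq_sum_of_candidate {σ : List (ℕ × ℤ)} (hσ : ∀ q ∈ σ, q.1.Prime ∧ q.2 = W.LFunction q.1)
    (d' : ℤ) (y : Fin g → ℤ)
    (hpiv : ∀ i, ∀ n < (u i).length, (u i).getD n 0 ≠ 0 →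
      (evalOpt N σ n).map (fun x ↦ d' * x) = some (∑ j, y j * (t j).getD n 0)) :
    ((d' : ℤ) : ℂ) • F = ∑ j, ((y j : ℤ) : ℂ) • C j := by
  refine eq_of_dual C t u d ht hu hdual hd hdim fun i n hn h0 ↦ ?_
  have hnK : n < K := lt_of_lt_of_le hn (hu i)
  obtain ⟨x, hx, hdx⟩ : ∃ x, evalOpt N σ n = some x ∧ d' * x = ∑ j, y j * (t j).getD n 0 := by
    have h := hpiv i n hn h0
    cases hv : evalOpt N σ n with
    | none => rw [hv] at h; exact absurd h (by simp)
    | some x => rw [hv, Option.map_some] at h; exact ⟨x, rfl, Option.some_injective _ h⟩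
  rw [map_smul, map_sum, smul_eq_mul, hF n, lFunction_eq_of_evalOpt D hσ hx]
  simp_rw [map_smul, smul_eq_mul]
  rw [Finset.sum_congr rfl fun j _ ↦ by rw [← (ht j) n hnK]]
  exact_mod_cast congrArg (fun z : ℤ ↦ (z : ℂ)) hdx

include D hF ht hu hdual hd hdim in
/-- **PINNING, LIST FORM.**  If every candidate of the sieve comes with a certified coordinate vector
(`cert = [(σ, d', y), …]` covering `runSieve`), then `d' • F = Σ y_j • C_j` for one of the listed `(σ, d', y)` —
the one whose `σ` is the truth. [cite: CremonaAlgorithms1997, §2.10] -/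
theorem exists_smul_eq_sum_of_certs (stages : List (ℕ × List (List ℤ))) (hps : ∀ st ∈ stages, st.1.Prime)
    (hrel : ∀ st ∈ stages, ∀ v ∈ st.2, v.length ≤ K ∧ ∀ j, dotList v (t j) = 0)
    (cert : List (List (ℕ × ℤ) × ℤ × List ℤ))
    (hcover : ∀ σ ∈ runSieve N K stages, σ ∈ cert.map Prod.fst)
    (hpiv : ∀ c ∈ cert, ∀ i, ∀ n < (u i).length, (u i).getD n 0 ≠ 0 →
      (evalOpt N c.1 n).map (fun x ↦ c.2.1 * x) = some (∑ j : Fin g, c.2.2.getD (j : ℕ) 0 * (t j).getD n 0)) :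
    ∃ c ∈ cert, c.1 = truth W (stages.map Prod.fst) ∧
      ((c.2.1 : ℤ) : ℂ) • F = ∑ j : Fin g, ((c.2.2.getD (j : ℕ) 0 : ℤ) : ℂ) • C j := by
  have hmem := hcover _ (truth_mem_runSieve_of_cert D F hF C t u d ht hu hdual hd hdim stages hps hrel)
  obtain ⟨c, hc, hc1⟩ := List.mem_map.mp hmem
  refine ⟨c, hc, hc1, ?_⟩
  have hσ : ∀ q ∈ c.1, q.1.Prime ∧ q.2 = W.LFunction q.1 := by
    rw [hc1]; exact truthful_truth (by simpa using hps)
  exact smul_eq_sum_of_candidate D F hF C t u d ht hu hdual hd hdim hσ c.2.1 (fun j : Fin g ↦ c.2.2.getD (j : ℕ) 0)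
    (hpiv c hc)

end Pinning

/-! ## §4 Certified `η`-quotient bases of `M₂(Γ₀(N))` and their tables -/

section EtaBasis

variable (N : ℕ) [NeZero N]

/-- **A list of certified holomorphic `η`-quotients gives a family in `M₂(Γ₀(N))`.**  Entry `(L, t)`: exponent list and
Newman witness (`t² = ∏ δ^{|r_δ|}`); the decidable premise is Newman's four conditions plus Ligozat non-negativity at every
cusp. [cite: Ligozat1975, Ch. 3] [cite: Koehler2011, §2.1] -/
theorem exists_etaModularForms (Ls : List (List (ℕ × ℤ) × ℕ))
    (h : ∀ p ∈ Ls, (∑ δ ∈ N.divisors, expFn p.1 δ = 4) ∧ ((24 : ℤ) ∣ ∑ δ ∈ N.divisors, (δ : ℤ) * expFn p.1 δ) ∧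
      ((24 : ℤ) ∣ ∑ δ ∈ N.divisors, ((N / δ : ℕ) : ℤ) * expFn p.1 δ) ∧
      (p.2 * p.2 = ∏ δ ∈ N.divisors, δ ^ (expFn p.1 δ).natAbs) ∧ (∀ c ∈ N.divisors, 0 ≤ cuspOrder24 N (expFn p.1) c)) :
    ∃ C : Fin Ls.length → ModularForm (Gamma0 N) 2,
      ∀ i, ∀ τ : ℍ, C i τ = etaQuotient N (expFn (Ls[(i : ℕ)]).1) τ := by
  have hN : ∀ i : Fin Ls.length, NewmanCond N (expFn (Ls[(i : ℕ)]).1) 2 := fun i ↦ by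
    obtain ⟨h1, h2, h3, h4, -⟩ := h _ (List.getElem_mem i.isLt)
    exact ⟨by rw [h1]; norm_num, h2, h3, ⟨(Ls[(i : ℕ)]).2, h4.symm⟩⟩
  exact ⟨fun i ↦ etaQuotientModularForm N (expFn (Ls[(i : ℕ)]).1) 2 (by decide) (hN i)
    (h _ (List.getElem_mem i.isLt)).2.2.2.2, fun i τ ↦ rfl⟩

/-- **Certified tables.**  If `C i = ∏ η(δτ)^{r_δ}` with `Σ δ r_δ = 24 a_i` and the list `tabs[i]` passes the convolution
certificate of `…EtaCoefficientTables` to depth `K`, then `tabs[i][n] = aₙ(C i)` for `n < K`. [cite: Koehler2011, §2.1] -/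
theorem tables_of_etaCerts {g : ℕ} (K : ℕ) (r : Fin g → ℕ → ℤ) (a : Fin g → ℕ) (tabs : Fin g → List ℤ)
    (C : Fin g → ModularForm (Gamma0 N) 2) (hC : ∀ i, ∀ τ : ℍ, C i τ = etaQuotient N (r i) τ)
    (hS : ∀ i, ∑ δ ∈ N.divisors, (δ : ℤ) * r i δ = 24 * a i)
    (hcert : ∀ i, mulList K (tabs i) (etaDenList K N (r i)) = etaNumList K N (r i) (a i)) :
    ∀ i, ∀ n < K, (((tabs i).getD n 0 : ℤ) : ℂ) = modCoefₗ N 2 n (C i) :=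
  fun i n hn ↦ qExpansion_coeff_eq_of_etaCertificate (C i) (r i) (hC i) (a i) (hS i) (tabs i) (hcert i) n hn

end EtaBasis

end Summit.BirchSwinnertonDyer.BirchSwinnertonDyer.Theorems.ManinLocalTwoThree.PinningKernel

end
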